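import Literature.NumberTheory.Automorphic.SupercuspidalTwoPlaceNonvanishing
import Literature.NumberTheory.Automorphic.GLnPlaceSplitting
import Literature.NumberTheory.Automorphic.GLnCuspidalSpectrumSiegel
import Literature.NumberTheory.Automorphic.AutomorphicRepsGLCuspidalKFiniteGarding
import Literature.NumberTheory.Automorphic.UnramifiedHeckeScalarsProofs
import Literature.NumberTheory.Automorphic.AutomorphicFormsGLContinuous
import HarnessLib

/-!
# The product test functions `θ^{(v)} ⊗ ξ_v` are test functions (`IsTestFunctionGL`) for `θ` a
# test function and `ξ_v` locally constant
(Garrett, *Modern analysis of automorphic forms by example* (2018), §6.3 and §7.3: test functions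
on `GL_n(𝔸)` are finite sums of `f_∞ ⊗ f_fin` with `f_fin` locally constant of compact support;
Gelbart, *Automorphic forms on adele groups* (1975), §10, p. 153: `Φ_f = ∏_{v ∈ S} f_v ⊗ f`)

Topic `NumberTheory/Automorphic`; theorems only (no definition, no named fact, no instance
visible to importers). The tree's class of real test functions on `GL_n(𝔸_K)`
(`IsTestFunctionGL`: continuous, compactly supported, smooth in the archimedean variable, right
invariant under an admissible level) is the one for which the Hilbert–Schmidt identity
`Σ_j ‖R₀(Φ) e_j‖² = c⁻¹ ∫_X K_{Φ ⋆ Φ^*}(x, x) dx` is available for `Φ = η₁ + i η₂`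
(`GLnSupercuspTypeHilbertSchmidt`). This file shows that the product test functions of
`SupercuspidalPlaceNonvanishing` / `SupercuspidalTwoPlaceNonvanishing` are of this form:

* `GLn.toLocalAt_ofInfinite`, `GLn.awayFrom_mul_ofInfinite` — archimedean elements are trivial at
  the finite place `v`, so `s(g a) = s(g) a` for archimedean `a`;
* `GLn.toAdelic_toLocalAt_mem_principalCongruenceLevel`,
  `GLn.awayFrom_mem_principalCongruenceLevel` — `K(𝔫)` contains `ι_v(u_v)` and `s(u)` for `u ∈ K(𝔫)`;
* `exists_principalCongruenceLevel_le_of_mem_finiteLevelsGL` — every admissible level contains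
  some `K(𝔫)`, `𝔫 ≠ 0`;
* `IsTestFunctionGL.awayFrom_mul_local` — **for a test function `θ` and a locally constant
  compactly supported real `c` on `GL_n(K_v)`, `g ↦ θ(s g) c(g_v)` is a test function**;
* `exists_isTestFunctionGL_localTestFunction`, `exists_isTestFunctionGL_localTestFunction₂` —
  **`θ^{(v)} ⊗ ξ = η₁ + i η₂` and `θ^{(v₁v₂)} ⊗ ξ₁ ⊗ ξ₂ = η₁ + i η₂` with `η₁, η₂` test functions**,
  for `θ` a test function and `ξ`, `ξ_i` locally constant (right invariant under open subgroups)
  of compact support — in particular for the supercusp forms of `SupercuspidalTestFunctions`.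

## References

* P. Garrett, *Modern analysis of automorphic forms by example* (2018), §6.3, §7.3 [Garrett2018].
* S. Gelbart, *Automorphic forms on adele groups*, Ann. of Math. Studies 83 (1975), §10, p. 153
  [Gelbart1975].
-/

noncomputable section

-- (as in `AdelicGLnGlue` / `GLnCuspidalSpectrumSiegel`: the Lie-ring structure on matrices through
-- which `IsArchSmooth` is phrased, and classical decidability for the `Fintype` instances on the
-- index types of `mixedSpace K`)
attribute [local instance 100] LieRing.ofAssociativeRing

open scoped MatrixGroups Matrix ContDiff NNReal Classical
open MeasureTheory Set Filter IsDedekindDomain NumberField NumberField.mixedEmbedding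
open _root_.Topology

namespace Literature.NumberTheory.Automorphic

section Algebra

variable {n : ℕ} {K : Type} [Field K] [NumberField K] {v : HeightOneSpectrum (𝓞 K)}

/-- **Archimedean elements are trivial at every finite place**: `(GLn.ofInfinite x)_v = 1`.
[folklore] -/
theorem GLn.toLocalAt_ofInfinite (x : GL (Fin n) (mixedSpace K)) :
    GLn.toLocalAt n K v (GLn.ofInfinite n K x) = 1 := by
  refine Matrix.GeneralLinearGroup.ext fun i j => ?_
  rw [GLn.toLocalAt_apply, AdelicGroupData.gl_toLocal]
  change AdelicGroupData.adeleEval K v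
      ((GLn.ofInfinite n K x : Matrix (Fin n) (Fin n) (AdeleRing (𝓞 K) K)) i j) =
    (1 : Matrix (Fin n) (Fin n) (v.adicCompletion K)) i j
  rw [AdelicGroupData.adeleEval_apply, GLn.coe_ofInfinite_apply]
  change ((1 : Matrix (Fin n) (Fin n) (FiniteAdeleRing (𝓞 K) K)) i j) v = _
  rw [Matrix.one_apply, Matrix.one_apply]
  split_ifs <;> rfl

/-- `s(a) = a` for archimedean `a = GLn.ofInfinite x` (it is trivial at `v`). [folklore] -/
theorem GLn.awayFrom_ofInfinite (x : GL (Fin n) (mixedSpace K)) :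
    GLn.awayFrom n K v (GLn.ofInfinite n K x) = GLn.ofInfinite n K x := by
  refine GLn.awayFrom_eq_self_of_mem_ker ?_
  rw [MonoidHom.mem_ker]
  exact GLn.toLocalAt_ofInfinite x

/-- **`ι_v(u_v) ∈ K(𝔫)` for `u ∈ K(𝔫)`**: the principal congruence subgroups are products of
local levels. [folklore] -/
theorem GLn.ofLocal_toLocalAt_mem_principalCongruenceLevel {𝔫 : Ideal (𝓞 K)}
    {u : GL (Fin n) (AdeleRing (𝓞 K) K)} (hu : u ∈ principalCongruenceLevel n K 𝔫) :
    GLn.ofLocal n K v (GLn.toLocalAt n K v u) ∈ principalCongruenceLevel n K 𝔫 := by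
  rw [mem_principalCongruenceLevel_iff] at hu ⊢
  have h1 : GLn.toLocalAt n K v u ∈ valuedCongruenceSubgroup (Fin n) (1 : WithZero (Multiplicative ℤ)) :=
    toLocal_mem_valuedCongruenceSubgroup_one hu.1 v
  refine ⟨isMaximalAt_glIntegralLevel n K v ⟨_, h1, rfl⟩, fun w => ?_⟩
  by_cases hw : w = v
  · subst hw
    rw [GLn.toLocal_ofLocal]
    exact hu.2 w
  · rw [GLn.toLocal_ofLocal_of_ne hw]
    exact one_mem _

/-- **`s(u) = u ι_v(u_v)⁻¹ ∈ K(𝔫)` for `u ∈ K(𝔫)`** (`GLn.awayFrom`, spelled inside `GL_n(𝔸_K)`).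
[folklore] -/
theorem GLn.mul_ofLocal_toLocalAt_inv_mem_principalCongruenceLevel {𝔫 : Ideal (𝓞 K)}
    {u : GL (Fin n) (AdeleRing (𝓞 K) K)} (hu : u ∈ principalCongruenceLevel n K 𝔫) :
    u * (GLn.ofLocal n K v (GLn.toLocalAt n K v u))⁻¹ ∈ principalCongruenceLevel n K 𝔫 :=
  mul_mem hu (inv_mem (GLn.ofLocal_toLocalAt_mem_principalCongruenceLevel hu))

/-- **Every admissible level contains a principal congruence subgroup inside any neighbourhood of
`1`**: for `U ∈ finiteLevelsGL` and `N ∈ 𝓝 1` there is `𝔫 ≠ 0` with `K(𝔫) ≤ U` and `K(𝔫) ⊆ N`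
(`U = {1} × U₀` with `U₀` open in `GL_n(𝔸_K^∞)`; the `K(𝔫)` form a neighbourhood basis of `1`,
`exists_principalCongruenceLevel_subset`, and lie in `{1} × GL_n(𝔸_K^∞)`). [folklore] -/
theorem exists_principalCongruenceLevel_le_of_mem_finiteLevelsGL
    {U : Subgroup (GL (Fin n) (AdeleRing (𝓞 K) K))} (hU : U ∈ finiteLevelsGL n K)
    {N : Set (GL (Fin n) (AdeleRing (𝓞 K) K))} (hN : N ∈ 𝓝 (1 : GL (Fin n) (AdeleRing (𝓞 K) K))) :
    ∃ 𝔫 : Ideal (𝓞 K), 𝔫 ≠ 0 ∧ principalCongruenceLevel n K 𝔫 ≤ U ∧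
      (principalCongruenceLevel n K 𝔫 : Set (GL (Fin n) (AdeleRing (𝓞 K) K))) ⊆ N := by
  obtain ⟨U₀, hU₀o, hU₀c, rfl⟩ := hU
  have hS : (GLn.sndHom n K) ⁻¹' (U₀ : Set (GL (Fin n) (FiniteAdeleRing (𝓞 K) K))) ∈
      𝓝 (1 : GL (Fin n) (AdeleRing (𝓞 K) K)) :=
    (GLn.continuous_sndHom (n := n) (K := K)).continuousAt.preimage_mem_nhds
      (by rw [map_one]; exact hU₀o.mem_nhds (one_mem U₀))
  obtain ⟨𝔫, h𝔫, hK⟩ := exists_principalCongruenceLevel_subset n K (Filter.inter_mem hS hN)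
  refine ⟨𝔫, h𝔫, fun u hu => ?_, fun u hu => (hK hu).2⟩
  obtain ⟨h, rfl⟩ := le_range_ofFinite_of_mem_finiteLevelsGL
    (principalCongruenceLevel_mem_finiteLevelsGL_holds n K h𝔫) hu
  have hh : h ∈ U₀ := by
    have h1 := (hK hu).1
    rw [Set.mem_preimage, GLn.sndHom_ofFinite] at h1
    exact h1
  exact ⟨h, hh, rfl⟩

/-- `(g h)_v = g_v h_v` for `g, h ∈ GL_n(𝔸_K)` (the projection is a homomorphism; spelled for the type
`GL (Fin n) (AdeleRing (𝓞 K) K)`). [folklore] -/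
theorem GLn.toLocalAt_mul' (g h : GL (Fin n) (AdeleRing (𝓞 K) K)) :
    GLn.toLocalAt n K v (g * h) = GLn.toLocalAt n K v g * GLn.toLocalAt n K v h :=
  map_mul (GLn.toLocalAt n K v) g h

/-- `s(g h) = s(g) s(h)` for `g, h ∈ GL_n(𝔸_K)` (`GLn.awayFrom_mul`, spelled for the type
`GL (Fin n) (AdeleRing (𝓞 K) K)`). [folklore] -/
theorem GLn.awayFrom_mul' (g h : GL (Fin n) (AdeleRing (𝓞 K) K)) :
    GLn.awayFrom n K v (g * h) = GLn.awayFrom n K v g * GLn.awayFrom n K v h :=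
  GLn.awayFrom_mul g h

end Algebra

/-! ### The glue: `θ^{(v)} ⊗ c` is a test function -/

section Glue

variable {n : ℕ} {K : Type} [Field K] [NumberField K] {v : HeightOneSpectrum (𝓞 K)}

open scoped Matrix.Norms.Operator in
/-- **`g ↦ θ(s g) c(g_v)` is a test function** for `θ` a test function on `GL_n(𝔸_K)` and `c` a real
function on `GL_n(K_v)` right invariant under an open subgroup `U_c` and of compact support
(Garrett (2018), §7.3: `f_∞ ⊗ f_fin` with `f_fin` locally constant): continuity and compact support
are clear; archimedean smoothness at `g` is that of `θ` at `s(g)` since archimedean elements `a`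
are trivial at `v` (`s(g a) = s(g) a`, `(g a)_v = g_v`); a level is `K(𝔫) ≤ U_θ` with
`K(𝔫)_v ≤ U_c` (`exists_principalCongruenceLevel_le_of_mem_finiteLevelsGL`), for which
`s(g u) = s(g) u ι_v(u_v)⁻¹` with `u, ι_v(u_v) ∈ K(𝔫) ≤ U_θ`. [cite: Garrett2018, §6.3 (PDF pp. 274–275)] -/
theorem IsTestFunctionGL.awayFrom_mul_local {θ : GL (Fin n) (AdeleRing (𝓞 K) K) → ℝ}
    (hθ : IsTestFunctionGL n K θ) {c : GL (Fin n) (v.adicCompletion K) → ℝ}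
    {Uc : Subgroup (GL (Fin n) (v.adicCompletion K))}
    (hUo : IsOpen (Uc : Set (GL (Fin n) (v.adicCompletion K))))
    (hcU : ∀ (x : GL (Fin n) (v.adicCompletion K)), ∀ k ∈ Uc, c (x * k) = c x)
    (hcs : HasCompactSupport c) :
    IsTestFunctionGL n K (fun g => θ (GLn.awayFrom n K v g) * c (GLn.toLocalAt n K v g)) := by
  haveI : T2Space (AdelicGroupData.gl n K).Adelic := t2Space_gl n K
  have hcc : Continuous c := continuous_of_right_invariant hUo hcU
  refine ⟨?_, ?_, ?_, ?_⟩
  · -- continuity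
    exact (hθ.continuous.comp (GLn.continuous_awayFrom n K v)).mul
      (hcc.comp (GLn.continuous_toLocalAt n K v))
  · -- compact support: inside `tsupport θ · ι_v(tsupport c)`
    refine HasCompactSupport.intro
      (hθ.hasCompactSupport.isCompact.mul (hcs.isCompact.image (GLn.continuous_toAdelic n K v)))
      fun g hg => ?_
    by_contra hne
    have h1 : θ (GLn.awayFrom n K v g) ≠ 0 := fun h0 => hne (by rw [h0, zero_mul])
    have h2 : c (GLn.toLocalAt n K v g) ≠ 0 := fun h0 => hne (by rw [h0, mul_zero])
    exact hg ⟨GLn.awayFrom n K v g, subset_tsupport _ h1, GLn.toAdelic n K v (GLn.toLocalAt n K v g),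
      ⟨_, subset_tsupport _ h2, rfl⟩, GLn.awayFrom_mul_toAdelic g⟩
  · -- archimedean smoothness: that of `θ` at `s(g)`, times the constant `c(g_v)`
    intro g
    have h := (hθ.isArchSmooth (GLn.awayFrom n K v g)).const_smul ((c (GLn.toLocalAt n K v g) : ℝ) : ℂ)
    convert h using 1
    funext X
    dsimp only
    rw [AutomorphyDatum.gl_ofArch_apply, map_mul, GLn.toLocalAt_ofInfinite, mul_one,
      GLn.awayFrom_mul, GLn.awayFrom_ofInfinite, Complex.ofReal_mul, smul_eq_mul, mul_comm]
  · -- a level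
    obtain ⟨Uθ, hUθ, hθU⟩ := hθ.exists_level
    have hN : (GLn.toLocalAt n K v) ⁻¹' (Uc : Set (GL (Fin n) (v.adicCompletion K))) ∈
        𝓝 (1 : GL (Fin n) (AdeleRing (𝓞 K) K)) :=
      (GLn.continuous_toLocalAt n K v).continuousAt.preimage_mem_nhds (by
        have h1 : GLn.toLocalAt n K v (1 : GL (Fin n) (AdeleRing (𝓞 K) K)) = 1 := map_one _
        rw [h1]
        exact hUo.mem_nhds (one_mem Uc))
    obtain ⟨𝔫, h𝔫, hle, hsub⟩ := exists_principalCongruenceLevel_le_of_mem_finiteLevelsGL hUθ hN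
    refine ⟨principalCongruenceLevel n K 𝔫, principalCongruenceLevel_mem_finiteLevelsGL_holds n K h𝔫,
      fun u hu g => ?_⟩
    have huv : GLn.toLocalAt n K v u ∈ Uc := hsub hu
    have h1 : c (GLn.toLocalAt n K v (g * u)) = c (GLn.toLocalAt n K v g) := by
      rw [GLn.toLocalAt_mul']
      exact hcU _ _ huv
    have hsu : GLn.awayFrom n K v u ∈ Uθ := hle (GLn.mul_ofLocal_toLocalAt_inv_mem_principalCongruenceLevel hu)
    have h2 : θ (GLn.awayFrom n K v (g * u)) = θ (GLn.awayFrom n K v g) := by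
      rw [GLn.awayFrom_mul']
      exact hθU _ hsu _
    change θ (GLn.awayFrom n K v (g * u)) * c (GLn.toLocalAt n K v (g * u)) =
      θ (GLn.awayFrom n K v g) * c (GLn.toLocalAt n K v g)
    rw [h1, h2]

/-- **`θ^{(v)} ⊗ ξ = η₁ + i η₂` with test functions `η₁`, `η₂`** for `θ` a test function and `ξ` a
complex function on `GL_n(K_v)` right invariant under an open subgroup and of compact support
(`η₁ = θ(s ·) Re ξ((·)_v)`, `η₂ = θ(s ·) Im ξ((·)_v)`; `IsTestFunctionGL.awayFrom_mul_local`): the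
product test functions `localTestFunction v θ ξ` of `SupercuspidalPlaceNonvanishing` are in the
class for which `GLnSupercuspTypeHilbertSchmidt` computes the Hilbert–Schmidt norm of `R₀`.
[cite: Garrett2018, §6.3 (PDF pp. 274–275)] -/
theorem exists_isTestFunctionGL_localTestFunction {θ : GL (Fin n) (AdeleRing (𝓞 K) K) → ℝ}
    (hθ : IsTestFunctionGL n K θ) {ξ : GL (Fin n) (v.adicCompletion K) → ℂ}
    {U : Subgroup (GL (Fin n) (v.adicCompletion K))} (hUo : IsOpen (U : Set (GL (Fin n) (v.adicCompletion K))))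
    (hξU : ∀ (x : GL (Fin n) (v.adicCompletion K)), ∀ k ∈ U, ξ (x * k) = ξ x)
    (hξs : HasCompactSupport ξ) :
    ∃ η₁ η₂ : GL (Fin n) (AdeleRing (𝓞 K) K) → ℝ, IsTestFunctionGL n K η₁ ∧ IsTestFunctionGL n K η₂ ∧
      ∀ g, localTestFunction v θ ξ g = η₁ g + η₂ g * Complex.I := by
  refine ⟨fun g => θ (GLn.awayFrom n K v g) * (ξ (GLn.toLocalAt n K v g)).re,
    fun g => θ (GLn.awayFrom n K v g) * (ξ (GLn.toLocalAt n K v g)).im,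
    hθ.awayFrom_mul_local hUo (fun x k hk => by show (ξ (x * k)).re = (ξ x).re; rw [hξU x k hk])
      (hξs.comp_left Complex.zero_re),
    hθ.awayFrom_mul_local hUo (fun x k hk => by show (ξ (x * k)).im = (ξ x).im; rw [hξU x k hk])
      (hξs.comp_left Complex.zero_im),
    fun g => ?_⟩
  rw [localTestFunction_apply]
  conv_lhs => rw [← Complex.re_add_im (ξ (GLn.toLocalAt n K v g))]
  push_cast
  ring

/-- **`θ^{(v₁v₂)} ⊗ ξ₁ ⊗ ξ₂ = η₁ + i η₂` with test functions `η₁`, `η₂`** for `θ` a test function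
and `ξ₁`, `ξ₂` complex functions on `GL_n(K_{v₁})`, `GL_n(K_{v₂})` right invariant under open
subgroups and of compact support (`exists_isTestFunctionGL_localTestFunction` at `v₂`, then at `v₁`,
and the algebra `(a₁ + i b₁) + i (a₂ + i b₂) = (a₁ - b₂) + i (b₁ + a₂)` of test functions): the
two-place product test functions of `SupercuspidalTwoPlaceNonvanishing` /
`SupercuspidalTwoPlaceLocalComponents` are in the class of `GLnSupercuspTypeHilbertSchmidt`.
[cite: Garrett2018, §6.3 (PDF pp. 274–275)] -/
theorem exists_isTestFunctionGL_localTestFunction₂ {v₁ v₂ : HeightOneSpectrum (𝓞 K)} (h : v₁ ≠ v₂)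
    {θ : GL (Fin n) (AdeleRing (𝓞 K) K) → ℝ} (hθ : IsTestFunctionGL n K θ)
    {ξ₁ : GL (Fin n) (v₁.adicCompletion K) → ℂ} {U₁ : Subgroup (GL (Fin n) (v₁.adicCompletion K))}
    (hU₁o : IsOpen (U₁ : Set (GL (Fin n) (v₁.adicCompletion K))))
    (hξU₁ : ∀ (x : GL (Fin n) (v₁.adicCompletion K)), ∀ k ∈ U₁, ξ₁ (x * k) = ξ₁ x)
    (hξ₁s : HasCompactSupport ξ₁)
    {ξ₂ : GL (Fin n) (v₂.adicCompletion K) → ℂ} {U₂ : Subgroup (GL (Fin n) (v₂.adicCompletion K))}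
    (hU₂o : IsOpen (U₂ : Set (GL (Fin n) (v₂.adicCompletion K))))
    (hξU₂ : ∀ (x : GL (Fin n) (v₂.adicCompletion K)), ∀ k ∈ U₂, ξ₂ (x * k) = ξ₂ x)
    (hξ₂s : HasCompactSupport ξ₂) :
    ∃ η₁ η₂ : GL (Fin n) (AdeleRing (𝓞 K) K) → ℝ, IsTestFunctionGL n K η₁ ∧ IsTestFunctionGL n K η₂ ∧
      ∀ g, localTestFunction₂ v₁ v₂ θ ξ₁ ξ₂ g = η₁ g + η₂ g * Complex.I := by
  -- at `v₂`: `θ(s₂ ·) ξ₂((·)_{v₂}) = a + i b`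
  obtain ⟨a, b, ha, hb, hab⟩ := exists_isTestFunctionGL_localTestFunction (v := v₂) hθ hU₂o hξU₂ hξ₂s
  -- at `v₁` with the test functions `a`, `b`
  obtain ⟨a₁, b₁, ha₁, hb₁, hab₁⟩ := exists_isTestFunctionGL_localTestFunction (v := v₁) ha hU₁o hξU₁ hξ₁s
  obtain ⟨a₂, b₂, ha₂, hb₂, hab₂⟩ := exists_isTestFunctionGL_localTestFunction (v := v₁) hb hU₁o hξU₁ hξ₁s
  refine ⟨a₁ + fun g => (-1) * b₂ g, b₁ + a₂, ha₁.add (hb₂.const_mul (-1)), hb₁.add ha₂, fun g => ?_⟩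
  have e : localTestFunction₂ v₁ v₂ θ ξ₁ ξ₂ g =
      localTestFunction v₁ a ξ₁ g + localTestFunction v₁ b ξ₁ g * Complex.I := by
    rw [localTestFunction₂_eq h, hab, localTestFunction_apply, localTestFunction_apply]
    ring
  rw [e, hab₁, hab₂]
  simp only [Pi.add_apply]
  push_cast
  ring_nf
  rw [Complex.I_sq]
  ring

end Glue

end Literature.NumberTheory.Automorphic
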